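import Literature.Combinatorics.Sahi2008.TotalOrder
import Literature.Combinatorics.Sahi2008.FKG
import Summits.CriticalPhenomena.PercolationContinuityZ3.Theorems.PercNearOneGluingNoHeavyLowerTailSahiSunflowerRowClosedForm
import Summits.CriticalPhenomena.PercolationContinuityZ3.Theorems.PercNearOneGluingNoHeavyLowerTailSahiTangentSixReals
import HarnessLib

/-!
# The tangent inequality `E₃ ≥ ∂E₃` on a chain (Sahi programme, cell prim-sahi, prover prim-sahi-p2 gen 32)

Support file (`--supports stmt-CriticalPhenomena-4575`).  No definitions, no named facts, no sorries; standard axioms.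
Memo `run/shared/lean/prim/prim-sahi/FROM-prim-sahi-p2-gen32-TANGENT.md`, `prim-sahi-p2/PROOF-E3.md` §42.

## What is proved

Let `μ` be a probability weight on a finite set `α` and `B_p` the coin of bias `p` on `Bool`.  For three functions `F, G, H` on
`Bool × α` with sections `f_a = F(a,·)` (`a = false, true`, written `0, 1`), the map `p ↦ E₃^{B_p ⊗ μ}(F,G,H)` is a cubic, and

  `T₃ := E₃|_{p=1} − ∂_p E₃|_{p=1}
       = 2⟨f₀g₀h₀⟩ + Σ_cyc (⟨f₁⟩−⟨f₀⟩)⟨g₁h₁⟩ + Σ_cyc ⟨f₀⟩⟨g₁⟩⟨h₁⟩ − Σ_cyc ⟨f₁⟩⟨g₀h₀⟩ − 2⟨f₁⟩⟨g₁⟩⟨h₁⟩`   (`⟨·⟩ = E_μ`).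

**The tangent inequality** is `T₃ ≥ 0` for increasing `F, G, H` (i.e. `f₀ ≤ f₁`, each section increasing).  In bond percolation, with
`α` the configurations off a root edge `e = s(s,z)` of weight `p` and `F, G, H` the star events `{s↔b}, {s↔c}, {s↔y}`, `T₃ ≥ 0` is EXACTLY the
inequality **R23** (`3c₂ ≥ 2c₃` for the Bernstein coefficients of `p ↦ E₃(P_{w[e↦p]})`) to which prim-sahi-p2 gen 30 reduced the increasing
star (`IncStar.incStar_nonneg_of_ratio23`); equivalently (given `E₃ ≥ 0` at the endpoints) the contraction inequality (CO)
`E₃^{B_p⊗μ}(F,G,H) ≥ p·E₃^{μ}(f₁,g₁,h₁)`, i.e. `p ↦ E₃/p` is non-increasing.  For `n = 2` the analogue is `Cov(f₀,g₀) + δ_f δ_g ≥ 0`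
(trivial); for `n = 3` it contains Sahi's `C₃` (take `f₀ = f₁`).  Exhaustive exact checks (memo §2) find no violation on `{0,1}^m × Bool`
(`m ≤ 3`, all product measures tried, all triples of up-sets), on the FKG lattices `{0,1}², {0,1}³, [3]×[2]` and on chains; here we PROVE it
on every finite CHAIN with every probability weight — the tangent analogue of Blinovsky's lemma (`sahiPositive_of_linearOrder`):

All statements are proved in the TWO-WEIGHT generality: bottom moments under a probability weight `ν₀`, top moments under `ν₁`, with `ν₀ ≼ ν₁` on
up-sets (every probability weight on `Bool × α` is `(a,x) ↦ (if a then p·ν₁ x else (1−p)·ν₀ x)`; for an FKG weight the sections are so ordered,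
`sections_dominated_of_fkg`), so they cover every FKG weight on `Bool × (chain)`, not only coin products:

* `tangent_chain_two_weights` — `T₃ ≥ 0` for indicators of up-sets `U₀ ⊆ U₁`, `V₀ ⊆ V₁`, `W₀ ⊆ W₁` of a finite linear order, bottom moments
  under `ν₀`, top moments under `ν₁`, `ν₀ ≼ ν₁` (from `SahiTangent.tangent_six_reals` of the companion file and `ν(U ∩ V) = min(ν U, ν V)`);
  `tangent_chain_upperSet` — the one-weight case `ν₀ = ν₁ = μ` (coin products).
* `sahiE_three_sections` — for ANY finite `α`, weights `ν₀, ν₁`, `p`, and `F : Fin 3 → Bool × α → ℝ`, with `ν = (p·ν₁ on top, (1−p)·ν₀ below)`: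
  `E₃^{ν}(F) − p·E₃^{ν₁}(top sections) = (1−p)·[(1−p)·E₃^{ν₀}(bottom sections) + p·T₃ + p(1−p)·δ₀δ₁δ₂]` (pure algebra over `Bool`);
  the dictionary tangent form ↔ contraction form.
* `sahiE_three_sections_chain_ge` — the contraction form on a chain: for `p ∈ [0,1]`, `ν₀ ≼ ν₁`,
  `p · E₃^{ν₁}(χ_{U₁}, χ_{V₁}, χ_{W₁}) ≤ E₃^{ν}(F_U, F_V, F_W)` with `F_U(a,x) = χ_{U_a}(x)` (the general increasing event of `Bool × α`),
  by the identity, `T₃ ≥ 0`, and Blinovsky's lemma for the bottom sections; `sahiE_three_coin_chain_ge` — the coin-product case;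
  `sahiE_three_fkg_chain_ge` — every FKG probability weight on `Bool × α` with `0 < ν(top) < 1`.

By trilinearity and the finite layer cake the function form (nonnegative increasing `F, G, H` on `Bool × α`) follows; it is not spelled out.
-/

namespace Summit.CriticalPhenomena.PercolationContinuityZ3.Theorems.SahiTangent

open Finset Literature.Combinatorics.Sahi2008
open scoped BigOperators

/-! ### Chains: masses of up-sets -/

section Chain

variable {α : Type*} [Fintype α] [DecidableEq α]

/-- `μ(A) ≥ 0` for a nonnegative weight. [folklore] -/
theorem ex_setInd_nonneg {μ : α → ℝ} (hμ₀ : ∀ x, 0 ≤ μ x) (A : Finset α) : 0 ≤ ex μ (setInd A) := by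
  rw [SahiDeltaSystem.Sun.ex_setInd_eq_sum]; exact Finset.sum_nonneg fun x _ => hμ₀ x

/-- `μ(A) ≤ μ(B)` for `A ⊆ B` and a nonnegative weight. [folklore] -/
theorem ex_setInd_mono {μ : α → ℝ} (hμ₀ : ∀ x, 0 ≤ μ x) {A B : Finset α} (h : A ⊆ B) :
    ex μ (setInd A) ≤ ex μ (setInd B) := by
  rw [SahiDeltaSystem.Sun.ex_setInd_eq_sum, SahiDeltaSystem.Sun.ex_setInd_eq_sum]; exact Finset.sum_le_sum_of_subset_of_nonneg h fun x _ _ => hμ₀ x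

/-- `μ(A) ≤ 1` for a probability weight. [folklore] -/
theorem ex_setInd_le_one {μ : α → ℝ} (hμ₀ : ∀ x, 0 ≤ μ x) (hμ₁ : ∑ x, μ x = 1) (A : Finset α) :
    ex μ (setInd A) ≤ 1 := by
  rw [SahiDeltaSystem.Sun.ex_setInd_eq_sum, ← hμ₁]; exact Finset.sum_le_sum_of_subset_of_nonneg (Finset.subset_univ A) fun x _ _ => hμ₀ x

/-- For `⊆`-comparable sets, `μ(A ∩ B) = min(μ A, μ B)` (nonnegative weight). [folklore] -/
theorem ex_setInd_inter_of_total {μ : α → ℝ} (hμ₀ : ∀ x, 0 ≤ μ x) {A B : Finset α} (h : A ⊆ B ∨ B ⊆ A) :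
    ex μ (setInd (A ∩ B)) = min (ex μ (setInd A)) (ex μ (setInd B)) := by
  rcases h with h | h
  · rw [Finset.inter_eq_left.2 h, min_eq_left (ex_setInd_mono hμ₀ h)]
  · rw [Finset.inter_eq_right.2 h, min_eq_right (ex_setInd_mono hμ₀ h)]

variable [LinearOrder α]

omit [Fintype α] [DecidableEq α] in
/-- Up-sets of a chain are nested. [folklore] -/
theorem upperSet_total {A B : Finset α} (hA : IsUpperSet (A : Set α)) (hB : IsUpperSet (B : Set α)) : A ⊆ B ∨ B ⊆ A := by
  rcases hA.total hB with h | h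
  · exact Or.inl (Finset.coe_subset.1 h)
  · exact Or.inr (Finset.coe_subset.1 h)

/-- **The tangent inequality on a chain, two weights** (`T₃ ≥ 0`): for probability weights `ν₀ ≼ ν₁` on a finite linear order (domination on
up-sets) and up-sets `U₀ ⊆ U₁`, `V₀ ⊆ V₁`, `W₀ ⊆ W₁`, writing `u_a = χ_{U_a}`, `⟨·⟩_a = E_{ν_a}`,
`0 ≤ 2⟨u₀v₀w₀⟩₀ + Σ_cyc (⟨u₁⟩₁−⟨u₀⟩₀)⟨v₁w₁⟩₁ + Σ_cyc ⟨u₀⟩₀⟨v₁⟩₁⟨w₁⟩₁ − Σ_cyc ⟨u₁⟩₁⟨v₀w₀⟩₀ − 2⟨u₁⟩₁⟨v₁⟩₁⟨w₁⟩₁`. [this work] -/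
theorem tangent_chain_two_weights {ν₀ ν₁ : α → ℝ} (h₀ : ∀ x, 0 ≤ ν₀ x) (h₁ : ∀ x, 0 ≤ ν₁ x) (h₁' : ∑ x, ν₁ x = 1)
    (hdom : ∀ U : Finset α, IsUpperSet (U : Set α) → ex ν₀ (setInd U) ≤ ex ν₁ (setInd U))
    {U₀ U₁ V₀ V₁ W₀ W₁ : Finset α} (hU₀ : IsUpperSet (U₀ : Set α)) (hU₁ : IsUpperSet (U₁ : Set α))
    (hV₀ : IsUpperSet (V₀ : Set α)) (hV₁ : IsUpperSet (V₁ : Set α)) (hW₀ : IsUpperSet (W₀ : Set α)) (hW₁ : IsUpperSet (W₁ : Set α))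
    (hU : U₀ ⊆ U₁) (hV : V₀ ⊆ V₁) (hW : W₀ ⊆ W₁) :
    0 ≤ 2 * ex ν₀ (setInd U₀ * setInd V₀ * setInd W₀)
        + (ex ν₁ (setInd U₁) - ex ν₀ (setInd U₀)) * ex ν₁ (setInd V₁ * setInd W₁)
        + (ex ν₁ (setInd V₁) - ex ν₀ (setInd V₀)) * ex ν₁ (setInd U₁ * setInd W₁)
        + (ex ν₁ (setInd W₁) - ex ν₀ (setInd W₀)) * ex ν₁ (setInd U₁ * setInd V₁)
        + ex ν₀ (setInd U₀) * ex ν₁ (setInd V₁) * ex ν₁ (setInd W₁) + ex ν₀ (setInd V₀) * ex ν₁ (setInd U₁) * ex ν₁ (setInd W₁)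
        + ex ν₀ (setInd W₀) * ex ν₁ (setInd U₁) * ex ν₁ (setInd V₁)
        - ex ν₁ (setInd U₁) * ex ν₀ (setInd V₀ * setInd W₀) - ex ν₁ (setInd V₁) * ex ν₀ (setInd U₀ * setInd W₀)
        - ex ν₁ (setInd W₁) * ex ν₀ (setInd U₀ * setInd V₀)
        - 2 * ex ν₁ (setInd U₁) * ex ν₁ (setInd V₁) * ex ν₁ (setInd W₁) := by
  have hUVW₀ : ex ν₀ (setInd U₀ * setInd V₀ * setInd W₀) = min (ex ν₀ (setInd U₀)) (min (ex ν₀ (setInd V₀)) (ex ν₀ (setInd W₀))) := by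
    rw [mul_assoc, setInd_mul, setInd_mul, ex_setInd_inter_of_total h₀, ex_setInd_inter_of_total h₀ (upperSet_total hV₀ hW₀)]
    rcases upperSet_total hV₀ hW₀ with h | h
    · rw [Finset.inter_eq_left.2 h]; exact upperSet_total hU₀ hV₀
    · rw [Finset.inter_eq_right.2 h]; exact upperSet_total hU₀ hW₀
  rw [hUVW₀, setInd_mul, setInd_mul, setInd_mul, setInd_mul, setInd_mul, setInd_mul,
    ex_setInd_inter_of_total h₁ (upperSet_total hV₁ hW₁), ex_setInd_inter_of_total h₁ (upperSet_total hU₁ hW₁),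
    ex_setInd_inter_of_total h₁ (upperSet_total hU₁ hV₁), ex_setInd_inter_of_total h₀ (upperSet_total hV₀ hW₀),
    ex_setInd_inter_of_total h₀ (upperSet_total hU₀ hW₀), ex_setInd_inter_of_total h₀ (upperSet_total hU₀ hV₀)]
  exact tangent_six_reals (ex_setInd_nonneg h₀ U₀) (ex_setInd_nonneg h₀ V₀) (ex_setInd_nonneg h₀ W₀)
    ((ex_setInd_mono h₀ hU).trans (hdom U₁ hU₁)) ((ex_setInd_mono h₀ hV).trans (hdom V₁ hV₁))
    ((ex_setInd_mono h₀ hW).trans (hdom W₁ hW₁))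
    (ex_setInd_le_one h₁ h₁' U₁) (ex_setInd_le_one h₁ h₁' V₁) (ex_setInd_le_one h₁ h₁' W₁)

/-- **The tangent inequality on a chain** (`T₃ ≥ 0`, one weight = coin products): for a probability weight `μ` on a finite linear order and
up-sets `U₀ ⊆ U₁`, `V₀ ⊆ V₁`, `W₀ ⊆ W₁` (sections of three increasing events of `Bool × α`), writing `u_a = χ_{U_a}` etc.,
`0 ≤ 2⟨u₀v₀w₀⟩ + Σ_cyc (⟨u₁⟩−⟨u₀⟩)⟨v₁w₁⟩ + Σ_cyc ⟨u₀⟩⟨v₁⟩⟨w₁⟩ − Σ_cyc ⟨u₁⟩⟨v₀w₀⟩ − 2⟨u₁⟩⟨v₁⟩⟨w₁⟩`. [this work] -/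
theorem tangent_chain_upperSet {μ : α → ℝ} (hμ₀ : ∀ x, 0 ≤ μ x) (hμ₁ : ∑ x, μ x = 1)
    {U₀ U₁ V₀ V₁ W₀ W₁ : Finset α} (hU₀ : IsUpperSet (U₀ : Set α)) (hU₁ : IsUpperSet (U₁ : Set α))
    (hV₀ : IsUpperSet (V₀ : Set α)) (hV₁ : IsUpperSet (V₁ : Set α)) (hW₀ : IsUpperSet (W₀ : Set α)) (hW₁ : IsUpperSet (W₁ : Set α))
    (hU : U₀ ⊆ U₁) (hV : V₀ ⊆ V₁) (hW : W₀ ⊆ W₁) :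
    0 ≤ 2 * ex μ (setInd U₀ * setInd V₀ * setInd W₀)
        + (ex μ (setInd U₁) - ex μ (setInd U₀)) * ex μ (setInd V₁ * setInd W₁)
        + (ex μ (setInd V₁) - ex μ (setInd V₀)) * ex μ (setInd U₁ * setInd W₁)
        + (ex μ (setInd W₁) - ex μ (setInd W₀)) * ex μ (setInd U₁ * setInd V₁)
        + ex μ (setInd U₀) * ex μ (setInd V₁) * ex μ (setInd W₁) + ex μ (setInd V₀) * ex μ (setInd U₁) * ex μ (setInd W₁)
        + ex μ (setInd W₀) * ex μ (setInd U₁) * ex μ (setInd V₁)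
        - ex μ (setInd U₁) * ex μ (setInd V₀ * setInd W₀) - ex μ (setInd V₁) * ex μ (setInd U₀ * setInd W₀)
        - ex μ (setInd W₁) * ex μ (setInd U₀ * setInd V₀)
        - 2 * ex μ (setInd U₁) * ex μ (setInd V₁) * ex μ (setInd W₁) :=
  tangent_chain_two_weights hμ₀ hμ₀ hμ₁ (fun _ _ => le_rfl) hU₀ hU₁ hV₀ hV₁ hW₀ hW₁ hU hV hW

end Chain

/-! ### Weights on `Bool × α`: the sections identity and the contraction form -/

section Coin

variable {α : Type*} [Fintype α]

/-- **`E₃` on `Bool × α` as a cubic in the top mass.**  For weights `ν₀, ν₁` on `α`, `p : ℝ`, the weight `ν = (p·ν₁ on top, (1−p)·ν₀ below)` on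
`Bool × α` and `F_i : Bool × α → ℝ` with sections `f_i^a = F_i(a,·)`: writing `c₀ = E₃^{ν₀}(f^0)`, `c₃ = E₃^{ν₁}(f^1)`, `T₃` as in the module
docstring (bottom moments under `ν₀`, top moments under `ν₁`) and `D = Π_i (⟨f_i^1⟩₁ − ⟨f_i^0⟩₀)`,
`E₃^{ν}(F) − p·c₃ = (1−p)·[(1−p)·c₀ + p·T₃ + p(1−p)·D]`.  Pure algebra (sums over `Bool × α`); no hypothesis on the weights. [this work] -/
theorem sahiE_three_sections (ν₀ ν₁ : α → ℝ) (p : ℝ) (F : Fin 3 → Bool × α → ℝ) :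
    sahiE (fun z : Bool × α => if z.1 then p * ν₁ z.2 else (1 - p) * ν₀ z.2) 3 F
      - p * sahiE ν₁ 3 ![fun x => F 0 (true, x), fun x => F 1 (true, x), fun x => F 2 (true, x)] =
    (1 - p) * ((1 - p) * sahiE ν₀ 3 ![fun x => F 0 (false, x), fun x => F 1 (false, x), fun x => F 2 (false, x)]
      + p * (2 * ex ν₀ (fun x => F 0 (false, x) * F 1 (false, x) * F 2 (false, x))
          + (ex ν₁ (fun x => F 0 (true, x)) - ex ν₀ (fun x => F 0 (false, x))) * ex ν₁ (fun x => F 1 (true, x) * F 2 (true, x))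
          + (ex ν₁ (fun x => F 1 (true, x)) - ex ν₀ (fun x => F 1 (false, x))) * ex ν₁ (fun x => F 0 (true, x) * F 2 (true, x))
          + (ex ν₁ (fun x => F 2 (true, x)) - ex ν₀ (fun x => F 2 (false, x))) * ex ν₁ (fun x => F 0 (true, x) * F 1 (true, x))
          + ex ν₀ (fun x => F 0 (false, x)) * ex ν₁ (fun x => F 1 (true, x)) * ex ν₁ (fun x => F 2 (true, x))
          + ex ν₀ (fun x => F 1 (false, x)) * ex ν₁ (fun x => F 0 (true, x)) * ex ν₁ (fun x => F 2 (true, x))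
          + ex ν₀ (fun x => F 2 (false, x)) * ex ν₁ (fun x => F 0 (true, x)) * ex ν₁ (fun x => F 1 (true, x))
          - ex ν₁ (fun x => F 0 (true, x)) * ex ν₀ (fun x => F 1 (false, x) * F 2 (false, x))
          - ex ν₁ (fun x => F 1 (true, x)) * ex ν₀ (fun x => F 0 (false, x) * F 2 (false, x))
          - ex ν₁ (fun x => F 2 (true, x)) * ex ν₀ (fun x => F 0 (false, x) * F 1 (false, x))
          - 2 * ex ν₁ (fun x => F 0 (true, x)) * ex ν₁ (fun x => F 1 (true, x)) * ex ν₁ (fun x => F 2 (true, x)))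
      + p * (1 - p) * ((ex ν₁ (fun x => F 0 (true, x)) - ex ν₀ (fun x => F 0 (false, x)))
          * (ex ν₁ (fun x => F 1 (true, x)) - ex ν₀ (fun x => F 1 (false, x)))
          * (ex ν₁ (fun x => F 2 (true, x)) - ex ν₀ (fun x => F 2 (false, x))))) := by
  rw [sahiE_three_apply, sahiE_three, sahiE_three]
  simp only [ex, Fintype.sum_prod_type, Fintype.sum_bool, if_true, if_false, Bool.false_eq_true, Pi.mul_apply, mul_assoc,
    ← Finset.mul_sum]
  ring

/-- **Contraction form of the tangent inequality on a chain, two weights.**  For probability weights `ν₀ ≼ ν₁` on a finite linear order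
(domination on up-sets), `p ∈ [0,1]`, the weight `ν = (p·ν₁ on top, (1−p)·ν₀ below)` on `Bool × α` and up-sets `U₀ ⊆ U₁`, `V₀ ⊆ V₁`,
`W₀ ⊆ W₁` (so that `F_U(a,x) = χ_{U_a}(x)` is the indicator of a general up-set of `Bool × α`):
`p · E₃^{ν₁}(χ_{U₁},χ_{V₁},χ_{W₁}) ≤ E₃^{ν}(F_U,F_V,F_W)` — "`E₃ ≥ P(top) · E₃(· | top)`", the chain case of the increasing-star
programme's (CO) (`IncStar.incStar_nonneg_of_contractionChord` consumes (CO) along root pairs of percolation). [this work] -/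
theorem sahiE_three_sections_chain_ge [DecidableEq α] [LinearOrder α] {ν₀ ν₁ : α → ℝ} (h₀ : ∀ x, 0 ≤ ν₀ x) (h₀' : ∑ x, ν₀ x = 1)
    (h₁ : ∀ x, 0 ≤ ν₁ x) (h₁' : ∑ x, ν₁ x = 1) (hdom : ∀ U : Finset α, IsUpperSet (U : Set α) → ex ν₀ (setInd U) ≤ ex ν₁ (setInd U))
    {p : ℝ} (hp₀ : 0 ≤ p) (hp₁ : p ≤ 1)
    {U₀ U₁ V₀ V₁ W₀ W₁ : Finset α} (hU₀ : IsUpperSet (U₀ : Set α)) (hU₁ : IsUpperSet (U₁ : Set α))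
    (hV₀ : IsUpperSet (V₀ : Set α)) (hV₁ : IsUpperSet (V₁ : Set α)) (hW₀ : IsUpperSet (W₀ : Set α)) (hW₁ : IsUpperSet (W₁ : Set α))
    (hU : U₀ ⊆ U₁) (hV : V₀ ⊆ V₁) (hW : W₀ ⊆ W₁) :
    p * sahiE ν₁ 3 ![setInd U₁, setInd V₁, setInd W₁] ≤
      sahiE (fun z : Bool × α => if z.1 then p * ν₁ z.2 else (1 - p) * ν₀ z.2) 3
        ![fun z => if z.1 then setInd U₁ z.2 else setInd U₀ z.2, fun z => if z.1 then setInd V₁ z.2 else setInd V₀ z.2,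
          fun z => if z.1 then setInd W₁ z.2 else setInd W₀ z.2] := by
  have key := sahiE_three_sections ν₀ ν₁ p
    ![fun z => if z.1 then setInd U₁ z.2 else setInd U₀ z.2, fun z => if z.1 then setInd V₁ z.2 else setInd V₀ z.2,
      fun z => if z.1 then setInd W₁ z.2 else setInd W₀ z.2]
  simp only [Matrix.cons_val_zero, Matrix.cons_val_one, Matrix.cons_val_two, Matrix.head_cons, Matrix.tail_cons,
    if_true, if_false, Bool.false_eq_true] at key
  -- the three nonnegative ingredients
  have hT := tangent_chain_two_weights h₀ h₁ h₁' hdom hU₀ hU₁ hV₀ hV₁ hW₀ hW₁ hU hV hW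
  have mU := monotone_setInd hU₀
  have mV := monotone_setInd hV₀
  have mW := monotone_setInd hW₀
  have hc₀ : 0 ≤ sahiE ν₀ 3 ![setInd U₀, setInd V₀, setInd W₀] :=
    sahiPositive_of_linearOrder h₀ h₀' 3 _ (fun i x => by fin_cases i <;> simp [setInd_nonneg])
      (fun i => by fin_cases i <;> simpa)
  have hD : 0 ≤ (ex ν₁ (setInd U₁) - ex ν₀ (setInd U₀)) * (ex ν₁ (setInd V₁) - ex ν₀ (setInd V₀))
      * (ex ν₁ (setInd W₁) - ex ν₀ (setInd W₀)) :=
    mul_nonneg (mul_nonneg (sub_nonneg.2 ((ex_setInd_mono h₀ hU).trans (hdom U₁ hU₁)))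
      (sub_nonneg.2 ((ex_setInd_mono h₀ hV).trans (hdom V₁ hV₁)))) (sub_nonneg.2 ((ex_setInd_mono h₀ hW).trans (hdom W₁ hW₁)))
  have e0 : (fun x => setInd U₀ x) = setInd U₀ := rfl
  have e1 : (fun x => setInd U₁ x) = setInd U₁ := rfl
  have e2 : (fun x => setInd V₀ x) = setInd V₀ := rfl
  have e3 : (fun x => setInd V₁ x) = setInd V₁ := rfl
  have e4 : (fun x => setInd W₀ x) = setInd W₀ := rfl
  have e5 : (fun x => setInd W₁ x) = setInd W₁ := rfl
  have m1 : (fun x => setInd U₀ x * setInd V₀ x * setInd W₀ x) = setInd U₀ * setInd V₀ * setInd W₀ := rfl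
  have m2 : (fun x => setInd V₁ x * setInd W₁ x) = setInd V₁ * setInd W₁ := rfl
  have m3 : (fun x => setInd U₁ x * setInd W₁ x) = setInd U₁ * setInd W₁ := rfl
  have m4 : (fun x => setInd U₁ x * setInd V₁ x) = setInd U₁ * setInd V₁ := rfl
  have m5 : (fun x => setInd V₀ x * setInd W₀ x) = setInd V₀ * setInd W₀ := rfl
  have m6 : (fun x => setInd U₀ x * setInd W₀ x) = setInd U₀ * setInd W₀ := rfl
  have m7 : (fun x => setInd U₀ x * setInd V₀ x) = setInd U₀ * setInd V₀ := rfl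
  rw [e0, e1, e2, e3, e4, e5, m1, m2, m3, m4, m5, m6, m7] at key
  have h1p : 0 ≤ 1 - p := sub_nonneg.2 hp₁
  nlinarith [key, mul_nonneg h1p (mul_nonneg h1p hc₀), mul_nonneg h1p (mul_nonneg hp₀ hT),
    mul_nonneg h1p (mul_nonneg (mul_nonneg hp₀ h1p) hD)]

/-- **Contraction form, coin products.**  For a probability weight `μ` on a finite linear order, `p ∈ [0,1]`, and up-sets `U₀ ⊆ U₁`,
`V₀ ⊆ V₁`, `W₀ ⊆ W₁`: `p · E₃^{μ}(χ_{U₁},χ_{V₁},χ_{W₁}) ≤ E₃^{B_p ⊗ μ}(F_U,F_V,F_W)`, i.e. `p ↦ E₃^{B_p⊗μ}/p` does not increase when the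
coin is conditioned to its top value. [this work] -/
theorem sahiE_three_coin_chain_ge [DecidableEq α] [LinearOrder α] {μ : α → ℝ} (hμ₀ : ∀ x, 0 ≤ μ x) (hμ₁ : ∑ x, μ x = 1)
    {p : ℝ} (hp₀ : 0 ≤ p) (hp₁ : p ≤ 1)
    {U₀ U₁ V₀ V₁ W₀ W₁ : Finset α} (hU₀ : IsUpperSet (U₀ : Set α)) (hU₁ : IsUpperSet (U₁ : Set α))
    (hV₀ : IsUpperSet (V₀ : Set α)) (hV₁ : IsUpperSet (V₁ : Set α)) (hW₀ : IsUpperSet (W₀ : Set α)) (hW₁ : IsUpperSet (W₁ : Set α))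
    (hU : U₀ ⊆ U₁) (hV : V₀ ⊆ V₁) (hW : W₀ ⊆ W₁) :
    p * sahiE μ 3 ![setInd U₁, setInd V₁, setInd W₁] ≤
      sahiE (fun z : Bool × α => if z.1 then p * μ z.2 else (1 - p) * μ z.2) 3
        ![fun z => if z.1 then setInd U₁ z.2 else setInd U₀ z.2, fun z => if z.1 then setInd V₁ z.2 else setInd V₀ z.2,
          fun z => if z.1 then setInd W₁ z.2 else setInd W₀ z.2] :=
  sahiE_three_sections_chain_ge hμ₀ hμ₁ hμ₀ hμ₁ (fun _ _ => le_rfl) hp₀ hp₁ hU₀ hU₁ hV₀ hV₁ hW₀ hW₁ hU hV hW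

/-- The sections of an FKG probability weight `ν` on `Bool × α` (`α` a finite chain) with `0 < ν(top) < 1` are ordered on up-sets:
`ν(U | bottom) ≤ ν(U | top)` — the FKG inequality for `χ_U ∘ snd` and `χ_{top}`. [cite: FortuinKasteleynGinibre1971, Thm. (Prop. 1)] -/
theorem sections_dominated_of_fkg [DecidableEq α] [LinearOrder α] {ν : Bool × α → ℝ} (hν : IsFKGMeasure ν)
    (hq₀ : 0 < ∑ x, ν (true, x)) (hq₁ : 0 < ∑ x, ν (false, x)) (U : Finset α) (hU : IsUpperSet (U : Set α)) :
    ex (fun x => ν (false, x) / ∑ y, ν (false, y)) (setInd U) ≤ ex (fun x => ν (true, x) / ∑ y, ν (true, y)) (setInd U) := by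
  have hg : Monotone (fun z : Bool × α => if z.1 then (1 : ℝ) else 0) := by
    intro a b hab
    have h1 : a.1 ≤ b.1 := hab.1
    rcases ha : a.1 with _ | _ <;> rcases hb : b.1 with _ | _ <;> simp only [ha, hb] at h1 ⊢ <;> norm_num
    exact absurd h1 (by decide)
  have hf : Monotone (fun z : Bool × α => setInd U z.2) := fun a b hab => monotone_setInd hU hab.2
  have key := ex_mul_ex_le_ex_mul hν (fun z => setInd_nonneg U z.2) (fun z => by positivity) hf hg
  have htot : ∑ z : Bool × α, ν z = 1 := hν.sum_eq_one
  rw [Fintype.sum_prod_type, Fintype.sum_bool] at htot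
  simp only [ex, Fintype.sum_prod_type, Fintype.sum_bool, if_true, if_false, Bool.false_eq_true, Pi.mul_apply, mul_one,
    mul_zero, Finset.sum_const_zero, add_zero] at key
  simp only [ex, div_mul_eq_mul_div, ← Finset.sum_div]
  rw [div_le_div_iff₀ hq₁ hq₀]
  -- key : (Σ ν(true,x) u x + Σ ν(false,x) u x) * Σ ν(true,x) ≤ Σ ν(true,x) u x   [total mass 1]
  have hsplit : ∑ x, ν (true, x) = 1 - ∑ x, ν (false, x) := by linarith
  nlinarith [key, hsplit, Finset.sum_nonneg (fun x (_ : x ∈ Finset.univ) => mul_nonneg (hν.nonneg (true, x)) (setInd_nonneg U x)),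
    Finset.sum_nonneg (fun x (_ : x ∈ Finset.univ) => mul_nonneg (hν.nonneg (false, x)) (setInd_nonneg U x))]

/-- **Contraction form for every FKG weight on `Bool × (chain)`.**  For an FKG probability weight `ν` on `Bool × α` (`α` a finite linear order,
product order) with `q = ν(top) ∈ (0,1)` and up-sets `U₀ ⊆ U₁`, `V₀ ⊆ V₁`, `W₀ ⊆ W₁` of `α` (`F_U(a,x) = χ_{U_a}(x)` the general up-set
indicator of `Bool × α`): `q · E₃^{ν(·|top)}(χ_{U₁},χ_{V₁},χ_{W₁}) ≤ E₃^{ν}(F_U,F_V,F_W)`. [this work] -/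
theorem sahiE_three_fkg_chain_ge [DecidableEq α] [LinearOrder α] {ν : Bool × α → ℝ} (hν : IsFKGMeasure ν)
    (hq₀ : 0 < ∑ x, ν (true, x)) (hq₁ : 0 < ∑ x, ν (false, x))
    {U₀ U₁ V₀ V₁ W₀ W₁ : Finset α} (hU₀ : IsUpperSet (U₀ : Set α)) (hU₁ : IsUpperSet (U₁ : Set α))
    (hV₀ : IsUpperSet (V₀ : Set α)) (hV₁ : IsUpperSet (V₁ : Set α)) (hW₀ : IsUpperSet (W₀ : Set α)) (hW₁ : IsUpperSet (W₁ : Set α))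
    (hU : U₀ ⊆ U₁) (hV : V₀ ⊆ V₁) (hW : W₀ ⊆ W₁) :
    (∑ x, ν (true, x)) * sahiE (fun x => ν (true, x) / ∑ y, ν (true, y)) 3 ![setInd U₁, setInd V₁, setInd W₁] ≤
      sahiE ν 3 ![fun z => if z.1 then setInd U₁ z.2 else setInd U₀ z.2, fun z => if z.1 then setInd V₁ z.2 else setInd V₀ z.2,
          fun z => if z.1 then setInd W₁ z.2 else setInd W₀ z.2] := by
  set q := ∑ x, ν (true, x) with hq
  set ν₁ : α → ℝ := fun x => ν (true, x) / q with hν₁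
  set ν₀ : α → ℝ := fun x => ν (false, x) / ∑ y, ν (false, y) with hν₀
  have htot : ∑ z : Bool × α, ν z = 1 := hν.sum_eq_one
  rw [Fintype.sum_prod_type, Fintype.sum_bool] at htot
  have hq1 : ∑ x, ν (false, x) = 1 - q := by rw [hq]; linarith
  have hrepr : ν = fun z : Bool × α => if z.1 then q * ν₁ z.2 else (1 - q) * ν₀ z.2 := by
    funext z; rcases z with ⟨b, x⟩
    cases b
    · simp only [Bool.false_eq_true, if_false, hν₀, ← hq1]
      rw [mul_div_cancel₀ _ (ne_of_gt hq₁)]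
    · simp only [if_true, hν₁]
      rw [mul_div_cancel₀ _ (ne_of_gt hq₀)]
  have h₀ : ∀ x, 0 ≤ ν₀ x := fun x => div_nonneg (hν.nonneg _) hq₁.le
  have h₁ : ∀ x, 0 ≤ ν₁ x := fun x => div_nonneg (hν.nonneg _) hq₀.le
  have h₀' : ∑ x, ν₀ x = 1 := by simp only [hν₀, ← Finset.sum_div]; exact div_self (ne_of_gt hq₁)
  have h₁' : ∑ x, ν₁ x = 1 := by simp only [hν₁, ← Finset.sum_div]; exact div_self (ne_of_gt hq₀)
  have hdom : ∀ U : Finset α, IsUpperSet (U : Set α) → ex ν₀ (setInd U) ≤ ex ν₁ (setInd U) :=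
    fun U hU' => sections_dominated_of_fkg hν hq₀ hq₁ U hU'
  have hqle : q ≤ 1 := by linarith [hq1, hq₁.le]
  have main := sahiE_three_sections_chain_ge h₀ h₀' h₁ h₁' hdom hq₀.le hqle hU₀ hU₁ hV₀ hV₁ hW₀ hW₁ hU hV hW
  rw [← hrepr] at main
  exact main

end Coin

end Summit.CriticalPhenomena.PercolationContinuityZ3.Theorems.SahiTangent
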